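import Summits.AtomisticToContinuum.Crystallization.Theorems.FrustratedLawDichotomyStrainedPatchFarSplit

/-!
# Strained patch — TAIL PACKING: the un-charted exterior tail (XTAIL) `ExtTail 𝓘 τ Xe` DISCHARGED to a per-host-row ARITHMETIC certificate `TailCert 𝓘 τ Xe`
# (decomp-a2c lens-5, generation 73 part 5, sequel of `…StrainedPatchFarSplit`; crux `AperiodicFrustratedLawGap`, stmt-AtomisticToContinuum-27623)

The un-charted partners `k` of a charted row `a` (`dist (z k) (z c) > 63/10`, `dist (z k) (z a) ≤ 7`) are only `7/10`-separated (hard core); their number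
inside `dist (z k) (z a) ≤ t` is bounded by VOLUME PACKING with an INSCRIBED BALL removed: the disjoint `7/20`-balls around them lie in
`B(z a, t + 7/20)` and miss every ball `B(q, R)` with `R + dist q (z a) ≤ t + 7/20`, `R + dist q (z c) ≤ 63/10 − 7/20` (`card_mul_add_le_of_separated`, Haar
measure, any finite-dimensional real normed space; `card · (7/20)³ + R³ ≤ (t + 7/20)³` in `ℝ³`).  ABEL SUMMATION over a monotone grid `t₀ = 63/10 − d̄ ≤ … ≤ t_m ≥ 7`
with the antitone weight `s⁻⁷ ≥ |V′(s)|` (`sum_inv_pow_le_abel`) then bounds `‖extUncharted z c a‖` by the closed-form `tailSum m t (tailN t R)` for every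
row with `dist (z a) (z c) ≤ d̄ ≤ 53/10` and every admissible grid/ball datum `TailData d̄ m t θ R` (`norm_extUncharted_le_tailSum`); rows without packing
data get the crude hard-core bound `crudeTail` (`norm_extUncharted_le_crude`).  On a `τ`-chart `dist (z a) (z c) ≤ dist (z₀ (e a)) (z₀ c₀) + τ`, so the
per-host-row certificate (TAILCERT) `TailCert 𝓘 τ Xe` [INSTRUMENTABLE · decidable real arithmetic per host row] implies (XTAIL): `extTail_of_tailCert`, and
the T-leaf records `coreOff_of_envelope_tailCert` / `coreOff_of_gammaTable_tailCert` have NO cluster-quantified analytic binder left besides the cover,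
host separation and the certificates.  No `sorry`, no new axioms, zero edits to landed declarations.
-/

namespace Summit.AtomisticToContinuum.Crystallization.Theorems.FrustratedLawDichotomyStrainedPatchTailPacking

open scoped BigOperators Classical RealInnerProductSpace ENNReal
open Set MeasureTheory
open Summit.AtomisticToContinuum.Crystallization.Theorems.FrustratedLawDichotomyMotifLemmas
open Summit.AtomisticToContinuum.Crystallization.Theorems.FrustratedLawDichotomyRangeCut
open Summit.AtomisticToContinuum.Crystallization.Theorems.FrustratedLawDichotomyAveragingCut
open Summit.AtomisticToContinuum.Crystallization.Theorems.FrustratedLawDichotomyStrainedPatchHomSplit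
open Summit.AtomisticToContinuum.Crystallization.Theorems.FrustratedLawDichotomyStrainedPatchCleanCollar
open Summit.AtomisticToContinuum.Crystallization.Theorems.FrustratedLawDichotomyStrainedPatchPhaseCut
open Summit.AtomisticToContinuum.Crystallization.Theorems.FrustratedLawDichotomyStrainedPatchCoreTube
open Summit.AtomisticToContinuum.Crystallization.Theorems.FrustratedLawDichotomyStrainedPatchStrainBands
open Summit.AtomisticToContinuum.Crystallization.Theorems.FrustratedLawDichotomyStrainedPatchHomIsometry
open Summit.AtomisticToContinuum.Crystallization.Theorems.FrustratedLawDichotomyStrainedPatchHomTubeIso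
open Summit.AtomisticToContinuum.Crystallization.Theorems.FrustratedLawDichotomyStrainedPatchEnvelopeLaw
open Summit.AtomisticToContinuum.Crystallization.Theorems.FrustratedLawDichotomyStrainedPatchEnvelopeTaylor
open Summit.AtomisticToContinuum.Crystallization.Theorems.FrustratedLawDichotomyStrainedPatchChartFamilies
open Summit.AtomisticToContinuum.Crystallization.Theorems.FrustratedLawDichotomyStrainedPatchChartFamiliesPinned
open Summit.AtomisticToContinuum.Crystallization.Theorems.FrustratedLawDichotomyStrainedPatchQuantSlaving
open Summit.AtomisticToContinuum.Crystallization.Theorems.FrustratedLawDichotomyStrainedPatchHostCells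
open Summit.AtomisticToContinuum.Crystallization.Theorems.FrustratedLawDichotomyStrainedPatchForceCap
open Summit.AtomisticToContinuum.Crystallization.Theorems.FrustratedLawDichotomyStrainedPatchTextureFloor
open Summit.AtomisticToContinuum.Crystallization.Theorems.FrustratedLawDichotomyStrainedPatchSVCharge
open Summit.AtomisticToContinuum.Crystallization.Theorems.FrustratedLawDichotomyStrainedPatchChargePrice
open Summit.AtomisticToContinuum.Crystallization.Theorems.FrustratedLawDichotomyStrainedPatchTaylorTop
open Summit.AtomisticToContinuum.Crystallization.Theorems.FrustratedLawDichotomyStrainedPatchTaylorCharge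
open Summit.AtomisticToContinuum.Crystallization.Theorems.FrustratedLawDichotomyStrainedPatchHostStep
open Summit.AtomisticToContinuum.Crystallization.Theorems.FrustratedLawDichotomyStrainedPatchBondCalculus
open Summit.AtomisticToContinuum.Crystallization.Theorems.FrustratedLawDichotomyStrainedPatchFarSplit

/-! ## §1. Volume packing with an inscribed ball removed -/

/-- ★ **PACKING WITH A HOLE** — in a finite-dimensional real normed space of dimension `n`: if the points of `S` are `r`-separated (`0 < r`), lie within `t` of `a`
and at distance `≥ ρ` from `c`, and a ball `B(q, R)` (`0 < R`) satisfies `R + dist q a ≤ t + r/2` and `R + dist q c ≤ ρ − r/2`, then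
`#S · (r/2)ⁿ + Rⁿ ≤ (t + r/2)ⁿ` (the `r/2`-balls around `S` and the ball `B(q, R)` are pairwise disjoint inside `B(a, t + r/2)`; Haar measure). [folklore] -/
theorem card_mul_add_le_of_separated {E : Type*} [NormedAddCommGroup E] [NormedSpace ℝ E] [FiniteDimensional ℝ E] (S : Finset E) (a c q : E)
    {r ρ t R : ℝ} (hr : 0 < r) (hR : 0 < R) (hsep : ∀ x ∈ S, ∀ y ∈ S, x ≠ y → r ≤ dist x y) (hSa : ∀ x ∈ S, dist x a ≤ t) (hSc : ∀ x ∈ S, ρ ≤ dist x c)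
    (hq1 : R + dist q a ≤ t + r / 2) (hq2 : R + dist q c ≤ ρ - r / 2) :
    (S.card : ℝ) * (r / 2) ^ Module.finrank ℝ E + R ^ Module.finrank ℝ E ≤ (t + r / 2) ^ Module.finrank ℝ E := by
  borelize E
  let μ : Measure E := Measure.addHaar
  set δ : ℝ := r / 2 with hδ
  have δpos : 0 < δ := by positivity
  have tδpos : 0 < t + δ := by linarith [dist_nonneg (x := q) (y := a)]
  set A := ⋃ x ∈ S, Metric.ball (x : E) δ with hA
  have D : Set.PairwiseDisjoint (S : Set E) (fun x => Metric.ball (x : E) δ) := by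
    rintro x hx y hy hxy
    apply Metric.ball_disjoint_ball
    have := hsep x hx y hy hxy
    linarith
  have hAbig : A ⊆ Metric.ball a (t + δ) := by
    refine iUnion₂_subset fun x hx => ?_
    apply Metric.ball_subset_ball'
    linarith [hSa x hx]
  have hBbig : Metric.ball q R ⊆ Metric.ball a (t + δ) := Metric.ball_subset_ball' hq1
  have hAB : Disjoint A (Metric.ball q R) := by
    rw [Set.disjoint_left]
    intro p hp hpq
    rw [hA, Set.mem_iUnion₂] at hp
    obtain ⟨x, hx, hpx⟩ := hp
    rw [Metric.mem_ball] at hpx hpq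
    have h1 : dist x q ≤ dist x p + dist p q := dist_triangle x p q
    have h2 : dist x c ≤ dist x q + dist q c := dist_triangle x q c
    rw [dist_comm] at hpx
    linarith [hSc x hx]
  have hμA : μ A = (S.card : ℝ≥0∞) * (ENNReal.ofReal (δ ^ Module.finrank ℝ E) * μ (Metric.ball 0 1)) := by
    rw [hA, measure_biUnion_finset D fun x _ => measurableSet_ball]
    simp only [μ.addHaar_ball_of_pos _ δpos, Finset.sum_const, nsmul_eq_mul]
  have hμB : μ (Metric.ball q R) = ENNReal.ofReal (R ^ Module.finrank ℝ E) * μ (Metric.ball 0 1) := μ.addHaar_ball_of_pos _ hR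
  have hμbig : μ (Metric.ball a (t + δ)) = ENNReal.ofReal ((t + δ) ^ Module.finrank ℝ E) * μ (Metric.ball 0 1) := μ.addHaar_ball_of_pos _ tδpos
  have I : μ A + μ (Metric.ball q R) ≤ μ (Metric.ball a (t + δ)) := by
    rw [← measure_union hAB measurableSet_ball]
    exact measure_mono (Set.union_subset hAbig hBbig)
  rw [hμA, hμB, hμbig, ← mul_assoc, ← add_mul] at I
  have hB0 : μ (Metric.ball 0 1) ≠ 0 := (Metric.measure_ball_pos _ _ zero_lt_one).ne'
  have hBtop : μ (Metric.ball 0 1) ≠ ∞ := measure_ball_lt_top.ne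
  have J : (S.card : ℝ≥0∞) * ENNReal.ofReal (δ ^ Module.finrank ℝ E) + ENNReal.ofReal (R ^ Module.finrank ℝ E) ≤ ENNReal.ofReal ((t + δ) ^ Module.finrank ℝ E) :=
    (ENNReal.mul_le_mul_iff_left hB0 hBtop).1 I
  have h1 : (S.card : ℝ≥0∞) * ENNReal.ofReal (δ ^ Module.finrank ℝ E) ≠ ∞ := ENNReal.mul_ne_top (ENNReal.natCast_ne_top _) ENNReal.ofReal_ne_top
  have K := ENNReal.toReal_mono ENNReal.ofReal_ne_top J
  rw [ENNReal.toReal_add h1 ENNReal.ofReal_ne_top, ENNReal.toReal_mul, ENNReal.toReal_natCast, ENNReal.toReal_ofReal (pow_nonneg δpos.le _),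
    ENNReal.toReal_ofReal (pow_nonneg hR.le _), ENNReal.toReal_ofReal (pow_nonneg tδpos.le _)] at K
  exact K

/-- ★ The `ℝ³` packing count solved for the cardinality: `#S ≤ ((t + r/2)³ − R³)/(r/2)³`. [folklore] -/
theorem card_le_of_separated_hole (S : Finset E3) (a c q : E3) {r ρ t R : ℝ} (hr : 0 < r) (hR : 0 < R)
    (hsep : ∀ x ∈ S, ∀ y ∈ S, x ≠ y → r ≤ dist x y) (hSa : ∀ x ∈ S, dist x a ≤ t) (hSc : ∀ x ∈ S, ρ ≤ dist x c)
    (hq1 : R + dist q a ≤ t + r / 2) (hq2 : R + dist q c ≤ ρ - r / 2) :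
    (S.card : ℝ) ≤ ((t + r / 2) ^ 3 - R ^ 3) / (r / 2) ^ 3 := by
  have h := card_mul_add_le_of_separated S a c q hr hR hsep hSa hSc hq1 hq2
  rw [finrank_euclideanSpace_fin] at h
  rw [le_div_iff₀ (by positivity)]
  linarith

/-! ## §2. Abel summation with an antitone power weight -/

/-- Pointwise layer-cake: for a monotone grid `t` with `0 < t 0` and `t 0 ≤ x ≤ t m`,
`x⁻⁷ ≤ (t m)⁻⁷ + Σ_{i=1}^{m} ((t (i−1))⁻⁷ − (t i)⁻⁷) · 𝟙[x ≤ t i]`. [formal bookkeeping] -/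
theorem inv_pow_le_layerCake (t : ℕ → ℝ) (h0 : 0 < t 0) (hmono : Monotone t) :
    ∀ (m : ℕ) (x : ℝ), t 0 ≤ x → x ≤ t m →
      x⁻¹ ^ 7 ≤ (t m)⁻¹ ^ 7 + ∑ i ∈ Finset.Icc 1 m, ((t (i - 1))⁻¹ ^ 7 - (t i)⁻¹ ^ 7) * (if x ≤ t i then (1 : ℝ) else 0) := by
  intro m
  induction m with
  | zero =>
    intro x hx _
    simp only [Finset.Icc_eq_empty_of_lt (Nat.zero_lt_one), Finset.sum_empty, add_zero]
    exact pow_le_pow_left₀ (inv_nonneg.2 (h0.le.trans hx)) (inv_anti₀ h0 hx) 7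
  | succ m ih =>
    intro x hx hxm
    rw [Finset.sum_Icc_succ_top (Nat.succ_le_succ (Nat.zero_le m)), Nat.add_sub_cancel, if_pos hxm, mul_one]
    by_cases hcase : x ≤ t m
    · have := ih x hx hcase
      linarith
    · have hlt : t m < x := lt_of_not_ge hcase
      have hzero : ∑ i ∈ Finset.Icc 1 m, ((t (i - 1))⁻¹ ^ 7 - (t i)⁻¹ ^ 7) * (if x ≤ t i then (1 : ℝ) else 0) = 0 := by
        refine Finset.sum_eq_zero fun i hi => ?_
        have him : t i ≤ t m := hmono (Finset.mem_Icc.1 hi).2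
        rw [if_neg (by linarith), mul_zero]
      rw [hzero, zero_add]
      have htm : 0 < t m := lt_of_lt_of_le h0 (hmono (Nat.zero_le m))
      have := pow_le_pow_left₀ (inv_nonneg.2 (htm.le.trans hlt.le)) (inv_anti₀ htm hlt.le) 7
      linarith

/-- ★ **ABEL SUMMATION** — for a monotone grid `t` (`0 < t 0`), reals `d k ∈ [t 0, t m]` (`k ∈ S`, `1 ≤ m`), and upper bounds `N i` on the cumulative counts
`#{k ∈ S : d k ≤ t i}` (`1 ≤ i ≤ m`): `Σ_{k ∈ S} (d k)⁻⁷ ≤ (t m)⁻⁷ N m + Σ_{i=1}^{m} ((t (i−1))⁻⁷ − (t i)⁻⁷) N i`. [folklore] -/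
theorem sum_inv_pow_le_abel {ι : Type*} (S : Finset ι) (d : ι → ℝ) (t N : ℕ → ℝ) {m : ℕ} (hm : 1 ≤ m) (h0 : 0 < t 0) (hmono : Monotone t)
    (hlo : ∀ k ∈ S, t 0 ≤ d k) (hhi : ∀ k ∈ S, d k ≤ t m) (hN : ∀ i, 1 ≤ i → i ≤ m → ((S.filter (fun k => d k ≤ t i)).card : ℝ) ≤ N i) :
    ∑ k ∈ S, (d k)⁻¹ ^ 7 ≤ (t m)⁻¹ ^ 7 * N m + ∑ i ∈ Finset.Icc 1 m, ((t (i - 1))⁻¹ ^ 7 - (t i)⁻¹ ^ 7) * N i := by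
  have hpos : ∀ i, 0 < t i := fun i => lt_of_lt_of_le h0 (hmono (Nat.zero_le i))
  have hc : ∀ i, 0 ≤ (t (i - 1))⁻¹ ^ 7 - (t i)⁻¹ ^ 7 := fun i =>
    sub_nonneg.2 (pow_le_pow_left₀ (inv_nonneg.2 (hpos i).le) (inv_anti₀ (hpos (i - 1)) (hmono (Nat.sub_le i 1))) 7)
  have hcardm : (S.card : ℝ) ≤ N m := by
    have h := hN m hm le_rfl
    rwa [Finset.filter_true_of_mem (fun k hk => hhi k hk)] at h
  calc ∑ k ∈ S, (d k)⁻¹ ^ 7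
      ≤ ∑ k ∈ S, ((t m)⁻¹ ^ 7 + ∑ i ∈ Finset.Icc 1 m, ((t (i - 1))⁻¹ ^ 7 - (t i)⁻¹ ^ 7) * (if d k ≤ t i then (1 : ℝ) else 0)) :=
        Finset.sum_le_sum fun k hk => inv_pow_le_layerCake t h0 hmono m (d k) (hlo k hk) (hhi k hk)
    _ = (S.card : ℝ) * (t m)⁻¹ ^ 7 + ∑ i ∈ Finset.Icc 1 m, ((t (i - 1))⁻¹ ^ 7 - (t i)⁻¹ ^ 7) * ((S.filter (fun k => d k ≤ t i)).card : ℝ) := by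
        rw [Finset.sum_add_distrib, Finset.sum_const, nsmul_eq_mul, Finset.sum_comm]
        congr 1
        refine Finset.sum_congr rfl fun i _ => ?_
        rw [← Finset.mul_sum, Finset.sum_boole]
    _ ≤ N m * (t m)⁻¹ ^ 7 + ∑ i ∈ Finset.Icc 1 m, ((t (i - 1))⁻¹ ^ 7 - (t i)⁻¹ ^ 7) * N i :=
        add_le_add (mul_le_mul_of_nonneg_right hcardm (pow_nonneg (inv_nonneg.2 (hpos m).le) _))
          (Finset.sum_le_sum fun i hi => mul_le_mul_of_nonneg_left (hN i (Finset.mem_Icc.1 hi).1 (Finset.mem_Icc.1 hi).2) (hc i))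
    _ = (t m)⁻¹ ^ 7 * N m + ∑ i ∈ Finset.Icc 1 m, ((t (i - 1))⁻¹ ^ 7 - (t i)⁻¹ ^ 7) * N i := by ring

/-! ## §3. The tail of one row: grid/ball data, the closed-form sum, and the bound -/

/-- ★ **TAIL DATA** for a row at centre distance `≤ d̄`: a monotone grid `t 0 = 63/10 − d̄ ≤ … ≤ t m ≥ 7` and, per grid point `i ∈ [1, m]`, an inscribed ball
on the segment from the row towards the centre — parameter `θ i ∈ [0, 1]`, radius `R i > 0`, `R i + θ i · d̄ ≤ t i + 7/20`, `R i + (1 − θ i) · d̄ ≤ 119/20`.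
[decidable real arithmetic; the census chooses `m, t, θ, R`] -/
def TailData (dbar : ℝ) (m : ℕ) (t θ R : ℕ → ℝ) : Prop :=
  t 0 = 63 / 10 - dbar ∧ 7 ≤ t m ∧ Monotone t ∧
    ∀ i : ℕ, 1 ≤ i → i ≤ m → 0 ≤ θ i ∧ θ i ≤ 1 ∧ 0 < R i ∧ R i + θ i * dbar ≤ t i + 7 / 20 ∧ R i + (1 - θ i) * dbar ≤ 119 / 20

/-- The cumulative COUNT BOUND at grid point `i`: `((t i + 7/20)³ − (R i)³)/(7/20)³`. -/
noncomputable def tailN (t R : ℕ → ℝ) (i : ℕ) : ℝ :=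
  ((t i + 7 / 20) ^ 3 - R i ^ 3) / (7 / 20) ^ 3

/-- The ABEL TAIL SUM `(t m)⁻⁷ N m + Σ_{i=1}^{m} ((t (i−1))⁻⁷ − (t i)⁻⁷) N i`. -/
noncomputable def tailSum (m : ℕ) (t N : ℕ → ℝ) : ℝ :=
  (t m)⁻¹ ^ 7 * N m + ∑ i ∈ Finset.Icc 1 m, ((t (i - 1))⁻¹ ^ 7 - (t i)⁻¹ ^ 7) * N i

/-- `tailSum 0`. [formal bookkeeping] -/
theorem tailSum_zero (t N : ℕ → ℝ) : tailSum 0 t N = (t 0)⁻¹ ^ 7 * N 0 := by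
  simp [tailSum]

/-- The one-step recursion `tailSum (m+1) = tailSum m + (t m)⁻⁷ (N (m+1) − N m)`. [formal bookkeeping] -/
theorem tailSum_succ (m : ℕ) (t N : ℕ → ℝ) : tailSum (m + 1) t N = tailSum m t N + (t m)⁻¹ ^ 7 * (N (m + 1) - N m) := by
  unfold tailSum
  rw [Finset.sum_Icc_succ_top (by omega : 1 ≤ m + 1), Nat.add_sub_cancel]
  ring

/-- ★ EVALUATION FORM (summation by parts undone; `Finset.range`, `simp`/`norm_num`-friendly for explicit rational data):
`tailSum m t N = (t 0)⁻⁷ N 0 + Σ_{i<m} (t i)⁻⁷ (N (i+1) − N i)`. [formal bookkeeping] -/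
theorem tailSum_eq_range (m : ℕ) (t N : ℕ → ℝ) : tailSum m t N = (t 0)⁻¹ ^ 7 * N 0 + ∑ i ∈ Finset.range m, (t i)⁻¹ ^ 7 * (N (i + 1) - N i) := by
  induction m with
  | zero => rw [tailSum_zero, Finset.sum_range_zero, add_zero]
  | succ m ih => rw [tailSum_succ, ih, Finset.sum_range_succ, add_assoc]

/-- ★ AFFINE-GRID constructor of tail data (the census form: grid `t i = 63/10 − d̄ + δ·i`, `0 ≤ δ`, `7 ≤ t m`, and the finitely many ball constraints
`i = 1 … m`, each decidable by `norm_num` after `interval_cases`). [formal bookkeeping] -/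
theorem tailData_affine {dbar δ : ℝ} {m : ℕ} {θ R : ℕ → ℝ} (hδ : 0 ≤ δ) (h7 : 7 ≤ 63 / 10 - dbar + δ * m)
    (h : ∀ i : ℕ, 1 ≤ i → i ≤ m → 0 ≤ θ i ∧ θ i ≤ 1 ∧ 0 < R i ∧ R i + θ i * dbar ≤ 63 / 10 - dbar + δ * i + 7 / 20 ∧ R i + (1 - θ i) * dbar ≤ 119 / 20) :
    TailData dbar m (fun i => 63 / 10 - dbar + δ * i) θ R := by
  refine ⟨by simp, by simpa using h7, fun a b hab => ?_, fun i hi1 him => h i hi1 him⟩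
  dsimp only
  have : (a : ℝ) ≤ b := by exact_mod_cast hab
  nlinarith

/-- The CRUDE hard-core tail `9261 · ((7/10)⁻¹³ + (7/10)⁻⁷)` (at most `21³` move-test partners, each bond force `≤ |V′| ≤ s⁻¹³ + s⁻⁷` at `s ≥ 7/10`). -/
noncomputable def crudeTail : ℝ :=
  9261 * ((7 / 10 : ℝ)⁻¹ ^ 13 + (7 / 10 : ℝ)⁻¹ ^ 7)

/-- `|ljD1 s| ≤ (7/10)⁻¹³ + (7/10)⁻⁷` for `7/10 ≤ s`. [formal bookkeeping] -/
theorem abs_ljD1_le_crude {s : ℝ} (hs : 7 / 10 ≤ s) : |ljD1 s| ≤ (7 / 10 : ℝ)⁻¹ ^ 13 + (7 / 10 : ℝ)⁻¹ ^ 7 := by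
  have hs0 : 0 < s := by linarith
  have hi : s⁻¹ ≤ (7 / 10 : ℝ)⁻¹ := (inv_le_inv₀ hs0 (by norm_num)).2 hs
  have hi0 : 0 ≤ s⁻¹ := inv_nonneg.2 hs0.le
  have h13 := pow_le_pow_left₀ hi0 hi 13
  have h7 := pow_le_pow_left₀ hi0 hi 7
  rw [ljD1]
  calc |-(s⁻¹ ^ 13) + s⁻¹ ^ 7| ≤ |-(s⁻¹ ^ 13)| + |s⁻¹ ^ 7| := abs_add_le _ _
    _ = s⁻¹ ^ 13 + s⁻¹ ^ 7 := by rw [abs_neg, abs_of_nonneg (pow_nonneg hi0 _), abs_of_nonneg (pow_nonneg hi0 _)]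
    _ ≤ _ := add_le_add h13 h7

/-- The un-charted partner set of a row has at most `9261 = 21³` members under the hard core. [formal bookkeeping: `card_ball_le` at radius `7`] -/
theorem card_extUnchartedSet_le {M : ℕ} {z : Fin M → E3} (hs : Sep z) (c a : Fin M) :
    (((moveNbrs 7 z a).filter (fun k => k ∉ ball (63 / 10) z c)).card : ℝ) ≤ 9261 := by
  have hsub : (moveNbrs 7 z a).filter (fun k => k ∉ ball (63 / 10) z c) ⊆ ball 7 z a := fun k hk =>
    mem_ball.2 (mem_extUnchartedSet.1 hk).2.1
  calc (((moveNbrs 7 z a).filter (fun k => k ∉ ball (63 / 10) z c)).card : ℝ) ≤ ((ball 7 z a).card : ℝ) := by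
        exact_mod_cast Finset.card_le_card hsub
    _ ≤ (2 * 7 / (7 / 10) + 1) ^ 3 := card_ball_le (by norm_num) hs a
    _ = 9261 := by norm_num

/-- ★ The CRUDE bound `‖extUncharted z c a‖ ≤ crudeTail` (every row, hard core only). [formal bookkeeping] -/
theorem norm_extUncharted_le_crude {M : ℕ} {z : Fin M → E3} (hs : Sep z) (c a : Fin M) : ‖extUncharted z c a‖ ≤ crudeTail := by
  refine (norm_extUncharted_le z c a).trans ?_
  calc ∑ k ∈ (moveNbrs 7 z a).filter (fun k => k ∉ ball (63 / 10) z c), |ljD1 (dist (z k) (z a))|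
      ≤ ∑ k ∈ (moveNbrs 7 z a).filter (fun k => k ∉ ball (63 / 10) z c), ((7 / 10 : ℝ)⁻¹ ^ 13 + (7 / 10 : ℝ)⁻¹ ^ 7) :=
        Finset.sum_le_sum fun k hk => abs_ljD1_le_crude (hs k a (mem_extUnchartedSet.1 hk).1)
    _ = (((moveNbrs 7 z a).filter (fun k => k ∉ ball (63 / 10) z c)).card : ℝ) * ((7 / 10 : ℝ)⁻¹ ^ 13 + (7 / 10 : ℝ)⁻¹ ^ 7) := by
        rw [Finset.sum_const, nsmul_eq_mul]
    _ ≤ 9261 * ((7 / 10 : ℝ)⁻¹ ^ 13 + (7 / 10 : ℝ)⁻¹ ^ 7) :=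
        mul_le_mul_of_nonneg_right (card_extUnchartedSet_le hs c a) (by positivity)
    _ = crudeTail := rfl

/-- ★ The cumulative PACKING COUNT of the un-charted partners within `t i` of the row, through the inscribed ball of `TailData`. [formal bookkeeping over §1] -/
theorem card_uncharted_le_tailN {M : ℕ} {z : Fin M → E3} (hs : Sep z) {c a : Fin M} {dbar : ℝ} (hd : dist (z a) (z c) ≤ dbar) {m : ℕ} {t θ R : ℕ → ℝ}
    (hD : TailData dbar m t θ R) {i : ℕ} (hi1 : 1 ≤ i) (him : i ≤ m) :
    ((((moveNbrs 7 z a).filter (fun k => k ∉ ball (63 / 10) z c)).filter (fun k => dist (z k) (z a) ≤ t i)).card : ℝ) ≤ tailN t R i := by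
  obtain ⟨hθ0, hθ1, hR, hq1, hq2⟩ := hD.2.2.2 i hi1 him
  set F := ((moveNbrs 7 z a).filter (fun k => k ∉ ball (63 / 10) z c)).filter (fun k => dist (z k) (z a) ≤ t i) with hF
  have hinj : Set.InjOn z F := fun k _ l _ hkl => by
    by_contra hne
    have := hs k l hne
    rw [hkl, dist_self] at this
    linarith
  have hd0 : 0 ≤ dist (z a) (z c) := dist_nonneg
  set q : E3 := z a + θ i • (z c - z a) with hq
  have hqa : dist q (z a) = θ i * dist (z a) (z c) := by
    rw [hq, dist_eq_norm, add_sub_cancel_left, norm_smul, Real.norm_of_nonneg hθ0, ← dist_eq_norm, dist_comm]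
  have hqc : dist q (z c) = (1 - θ i) * dist (z a) (z c) := by
    rw [hq, dist_eq_norm, show z a + θ i • (z c - z a) - z c = (1 - θ i) • (z a - z c) by
      rw [sub_smul, one_smul, smul_sub, smul_sub]; abel, norm_smul, Real.norm_of_nonneg (by linarith), ← dist_eq_norm]
  have h := card_le_of_separated_hole (F.image z) (z a) (z c) q (r := 7 / 10) (ρ := 63 / 10) (t := t i) (R := R i) (by norm_num) hR ?_ ?_ ?_ ?_ ?_
  · rw [Finset.card_image_of_injOn hinj] at h
    rw [tailN]
    convert h using 3 <;> norm_num
  · intro x hx y hy hxy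
    obtain ⟨k, -, rfl⟩ := Finset.mem_image.1 hx
    obtain ⟨l, -, rfl⟩ := Finset.mem_image.1 hy
    exact hs k l fun hkl => hxy (hkl ▸ rfl)
  · intro x hx
    obtain ⟨k, hk, rfl⟩ := Finset.mem_image.1 hx
    exact (Finset.mem_filter.1 hk).2
  · intro x hx
    obtain ⟨k, hk, rfl⟩ := Finset.mem_image.1 hx
    exact (not_le.1 fun h => (mem_extUnchartedSet.1 (Finset.mem_filter.1 hk).1).2.2 (mem_ball.2 h)).le
  · rw [hqa]
    have : θ i * dist (z a) (z c) ≤ θ i * dbar := mul_le_mul_of_nonneg_left hd hθ0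
    linarith
  · rw [hqc]
    have : (1 - θ i) * dist (z a) (z c) ≤ (1 - θ i) * dbar := mul_le_mul_of_nonneg_left hd (by linarith)
    linarith

/-- ★★ **THE TAIL OF ONE ROW** — hard core + centre distance `≤ d̄ ≤ 53/10` + tail data ⟹ `‖extUncharted z c a‖ ≤ tailSum m t (tailN t R)`.
[formal bookkeeping: `|V′(s)| ≤ s⁻⁷` for `s ≥ 1`, the packing counts, Abel summation] -/
theorem norm_extUncharted_le_tailSum {M : ℕ} {z : Fin M → E3} (hs : Sep z) {c a : Fin M} {dbar : ℝ} (hd : dist (z a) (z c) ≤ dbar) (hd53 : dbar ≤ 53 / 10)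
    {m : ℕ} (hm : 1 ≤ m) {t θ R : ℕ → ℝ} (hD : TailData dbar m t θ R) : ‖extUncharted z c a‖ ≤ tailSum m t (tailN t R) := by
  set U := (moveNbrs 7 z a).filter (fun k => k ∉ ball (63 / 10) z c) with hU
  have ht0 : t 0 = 63 / 10 - dbar := hD.1
  have h0 : 0 < t 0 := by rw [ht0]; linarith
  have hlo : ∀ k ∈ U, t 0 ≤ dist (z k) (z a) := fun k hk => by
    have := dist_uncharted_gt (a := a) (mem_extUnchartedSet.1 hk).2.2
    rw [ht0]; linarith
  have hhi : ∀ k ∈ U, dist (z k) (z a) ≤ t m := fun k hk => (mem_extUnchartedSet.1 hk).2.1.trans hD.2.1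
  refine (norm_extUncharted_le z c a).trans ?_
  calc ∑ k ∈ U, |ljD1 (dist (z k) (z a))| ≤ ∑ k ∈ U, (dist (z k) (z a))⁻¹ ^ 7 :=
        Finset.sum_le_sum fun k hk => abs_ljD1_le_of_one_le (by have := hlo k hk; rw [ht0] at this; linarith)
    _ ≤ (t m)⁻¹ ^ 7 * tailN t R m + ∑ i ∈ Finset.Icc 1 m, ((t (i - 1))⁻¹ ^ 7 - (t i)⁻¹ ^ 7) * tailN t R i :=
        sum_inv_pow_le_abel U (fun k => dist (z k) (z a)) t (tailN t R) hm h0 hD.2.2.1 hlo hhi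
          fun i hi1 him => card_uncharted_le_tailN hs hd hD hi1 him
    _ = tailSum m t (tailN t R) := rfl

/-! ## §4. The per-host-row certificate (TAILCERT) and the discharge of (XTAIL) -/

/-- ★ **(TAILCERT) `TailCert 𝓘 τ Xe`** [INSTRUMENTABLE · decidable real arithmetic per host row, NO cluster quantifier] — for every family instance and every
host row `h`: either the crude hard-core tail fits under `Xe h`, or the row is deep (`dist (z₀ h) (z₀ c₀) + τ ≤ 53/10`) and some tail datum at
`d̄ = dist (z₀ h) (z₀ c₀) + τ` has `tailSum ≤ Xe h`. -/
def TailCert (𝓘 : ChartFam) (τ : ℝ) (Xe : SlackTab) : Prop :=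
  ∀ (M₀ : ℕ) (z₀ : Fin M₀ → E3) (c₀ : Fin M₀), 𝓘 M₀ z₀ c₀ → ∀ h : Fin M₀,
    crudeTail ≤ Xe M₀ z₀ c₀ h ∨
      (dist (z₀ h) (z₀ c₀) + τ ≤ 53 / 10 ∧ ∃ (m : ℕ) (t θ R : ℕ → ℝ), 1 ≤ m ∧ TailData (dist (z₀ h) (z₀ c₀) + τ) m t θ R ∧
        tailSum m t (tailN t R) ≤ Xe M₀ z₀ c₀ h)

/-- On a chart the row's centre distance is read on the host up to `τ`: `dist (z a) (z c) ≤ dist (z₀ (e a)) (z₀ c₀) + τ`. [formal bookkeeping: coarse clause] -/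
theorem dist_le_host_add_tau {𝓘 : ChartFam} {τ t : ℝ} {M : ℕ} {z : Fin M → E3} {c : Fin M} {M₀ : ℕ} {z₀ : Fin M₀ → E3} {c₀ : Fin M₀} {e : Fin M → Fin M₀}
    (hch : ChartBy 𝓘 τ t z c z₀ c₀ e) {a : Fin M} (ha : a ∈ ball (63 / 10) z c) : dist (z a) (z c) ≤ dist (z₀ (e a)) (z₀ c₀) + τ := by
  have h1 := hch.2.2.1 a (mem_ball.1 ha)
  rw [dist_eq_norm] at h1
  rw [dist_eq_norm, dist_eq_norm]
  linarith [norm_le_norm_add_norm_sub' (z a - z c) (z₀ (e a) - z₀ c₀)]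

/-- ★★★ **(TAILCERT) ⟹ (XTAIL).** [formal bookkeeping: `norm_extUncharted_le_crude` / `norm_extUncharted_le_tailSum` + the host reading of the centre distance] -/
theorem extTail_of_tailCert {𝓘 : ChartFam} {τ : ℝ} {Xe : SlackTab} (hT : TailCert 𝓘 τ Xe) : ExtTail 𝓘 τ Xe := by
  intro M z c M₀ z₀ c₀ e t hz _ _ _ _ hch _ a ha _
  have hs : Sep z := hz.2.1
  rcases hT M₀ z₀ c₀ hch.1 (e a) with hcr | ⟨h53, m, tt, θ, R, hm, hD, hle⟩
  · exact (norm_extUncharted_le_crude hs c a).trans hcr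
  · exact (norm_extUncharted_le_tailSum hs (dist_le_host_add_tau hch ha) h53 hm hD).trans hle

/-! ## §5. The T-leaf records with the tail certificate -/

/-- ★★★ **THE T-LEAF RECORD, ALL TABLES CLOSED-FORM OR PER-HOST** — `[CORE-FAR]` from: the cover, `2τ < s₀`, host separation, `r + 2τ ≤ 7`, the per-host far
table (HFAR), the per-host-row TAIL CERTIFICATE (TAILCERT), a dominating slack column, the host top and host steps with the closed-form γ-envelope tail,
and the terminal certificate.  [formal bookkeeping: `coreOff_of_envelope_hostFarTab` + `extTail_of_tailCert`] -/
theorem coreOff_of_envelope_tailCert {𝓘 : ChartFam} {τ s₀ r : ℝ} {X Xh Xe : SlackTab} (k : ℕ → ℝ) (n : ℕ) (hτ : 0 ≤ τ)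
    (hcov : FamilyCover 𝓘 (24 / 5) (1 / 100) (1 / 8) τ) (hτs : 2 * τ < s₀) (hsep : HostSep 𝓘 s₀) (hr7 : r + 2 * τ ≤ 7)
    (hH : HostFarTab 𝓘 τ r Xh) (hT : TailCert 𝓘 τ Xe) (hdom : ∀ (M₀ : ℕ) (z₀ : Fin M₀ → E3) (c₀ h : Fin M₀), Xh M₀ z₀ c₀ h + Xe M₀ z₀ c₀ h ≤ X M₀ z₀ c₀ h)
    (h0 : HostTop 𝓘 τ bondD3 (cubicTail fun s => gammaMaj (s - 2 * τ)) r (k 0 * sigmaOne))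
    (hs : ∀ i : ℕ, i < n → HostStep 𝓘 τ sigmaOne bondD3 (cubicTail fun s => gammaMaj (s - 2 * τ)) r hessBlk0 force0 X (k i) (k (i + 1) * sigmaOne))
    (hcert : SlackCert 𝓘 τ (k n) sigmaOne hessBlk0 force0 X) : CoreOffTubeFloor (63 / 10) (63 / 10) (24 / 5) (1 / 100) 0 :=
  coreOff_of_envelope_hostFarTab k n hτ hcov hτs hsep hr7 hH (extTail_of_tailCert hT) hdom h0 hs hcert

/-- ★★★ The same record with a census γ-table `L` instead of the envelope. [formal bookkeeping] -/
theorem coreOff_of_gammaTable_tailCert {𝓘 : ChartFam} {τ s₀ r : ℝ} {L : ℝ → ℝ} {X Xh Xe : SlackTab} (k : ℕ → ℝ) (n : ℕ) (hτ : 0 ≤ τ)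
    (hcov : FamilyCover 𝓘 (24 / 5) (1 / 100) (1 / 8) τ) (hτs : 2 * τ < s₀)
    (hL : ∀ s : ℝ, s₀ ≤ s → s < r → ∀ s' : ℝ, |s' - s| ≤ 2 * τ → bondGamma s' ≤ L s) (hsep : HostSep 𝓘 s₀) (hr7 : r + 2 * τ ≤ 7)
    (hH : HostFarTab 𝓘 τ r Xh) (hT : TailCert 𝓘 τ Xe) (hdom : ∀ (M₀ : ℕ) (z₀ : Fin M₀ → E3) (c₀ h : Fin M₀), Xh M₀ z₀ c₀ h + Xe M₀ z₀ c₀ h ≤ X M₀ z₀ c₀ h)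
    (h0 : HostTop 𝓘 τ bondD3 (cubicTail L) r (k 0 * sigmaOne))
    (hs : ∀ i : ℕ, i < n → HostStep 𝓘 τ sigmaOne bondD3 (cubicTail L) r hessBlk0 force0 X (k i) (k (i + 1) * sigmaOne))
    (hcert : SlackCert 𝓘 τ (k n) sigmaOne hessBlk0 force0 X) : CoreOffTubeFloor (63 / 10) (63 / 10) (24 / 5) (1 / 100) 0 :=
  coreOff_of_gammaTable_hostFarTab k n hτ hcov hτs hL hsep hr7 hH (extTail_of_tailCert hT) hdom h0 hs hcert

end Summit.AtomisticToContinuum.Crystallization.Theorems.FrustratedLawDichotomyStrainedPatchTailPacking
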